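import Summits.AtomisticToContinuum.BoseEinsteinCondensation.Theorems.BECProbeMassFlowCloudMomentumAtomPinningBorn
import Literature.MathematicalPhysics.QuantumManyBody.PeriodicClusteringFromKyFanGap
import Mathlib.MeasureTheory.Integral.Average
import HarnessLib

/-!
# The fidelity pair at Born slack (the provable half of stub A `stub_fidelityPair` of crux
# `BECProbeMassFlow.CloudMomentumAtom`)

Helper file for the crux `BECProbeMassFlow.CloudMomentumAtom` (item stmt-AtomisticToContinuum-12310),
line `registered` (skeleton `Cruxes/CloudMomentumAtom/Lines/birth.lean`, lead c3, skeleton v7). Stub A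
(`stub_fidelityPair`) asks, at small density eventually in `N`, for EVERY slack `δ > 0`, for a pinned
`δ`-near-minimiser `Φ` and a free `δ`-near-minimiser `Ψ` with `|⟨Ψ, Φ⟩|² ≥ 1 − η`. This file proves the
statement with the PINNED slack inflated by the uniform Born term, at every `(N, L)` and with overlap
exactly `1`:

for every `δ > 0` there is ONE periodic trial state `Φ` which is simultaneously a free `δ`-near-minimiser
and a pinned `(δ + N L⁻³ ∫_{[0,L)³} v^per)`-near-minimiser (`stub_fidelityPairBornSlack`; at the crux's side
`L = sideLength ρ (N + 1)` the extra slack is `≤ ρ ∫_{ℝ³} v`, `stub_fidelityPairBornSlack_density`).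

Proof: take a free `δ`-near-minimiser `Ψ₀`; the cell average over the pinning point `x` of its pinned
energy `⟨Ψ₀, (H + V_x) Ψ₀⟩` is `⟨Ψ₀, HΨ₀⟩ + N L⁻³ ∫ v^per` (`lintegral_cell_impurityPeriodicEnergy`), so by
the first-moment method (`MeasureTheory.exists_le_setLAverage`) some pinning point `x₀ ∈ [0,L)³` does no
worse than the average; translating all bosons by `−x₀` (`PeriodicTrialState.exists_translate`,
`impurityPeriodicEnergy_translate`, `periodicEnergy_translate`) moves the scatterer back to the origin
without changing the free energy. So the whole content of stub A is the RELAXATION of the pinned slack from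
the Born scale `ρ∫v = O(ρ b)` (N-uniform but fixed) down to `o(1)` at fixed `N` (below the gap `~ L⁻²`),
i.e. from the displaced free ground state to the true pinned ground state, at fidelity cost `≤ η` uniformly
in `N` — the no-orthogonality-catastrophe statement proper (LEAD-REPORT-c3 §2).
-/

noncomputable section

namespace Summit.AtomisticToContinuum.BoseEinsteinCondensation.Cruxes.CloudMomentumAtom.Birth

open MeasureTheory Filter
open scoped ENNReal NNReal BigOperators ComplexConjugate
open Literature.MathematicalPhysics.QuantumManyBody.BoseGas
open Summit.AtomisticToContinuum.BoseEinsteinCondensation.Theorems.CorrectorClosure.HealingScaleKacInsertion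

variable {N : ℕ} {L : ℝ}

/-- The pinned energy of a fixed periodic trial state is a measurable function of the pinning point
(Tonelli: the scatterer potential is jointly measurable). [folklore] -/
theorem measurable_impurityPeriodicEnergy_left {v : ℝ → ℝ≥0∞} (hv : Measurable v)
    (Φ : PeriodicTrialState N L) : Measurable fun x : Space => impurityPeriodicEnergy v x Φ := by
  have hm : Measurable (Function.uncurry fun (x : Space) (X : Config N) =>
      impurityInteraction v L x X * (‖Φ.ψ X‖₊ : ℝ≥0∞) ^ 2) :=
    (measurable_impurityInteraction_uncurry hv L).mul (Φ.measurable_normSq.comp measurable_snd)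
  have h2 : Measurable fun x : Space =>
      ∫⁻ X in cellN N L, impurityInteraction v L x X * (‖Φ.ψ X‖₊ : ℝ≥0∞) ^ 2 :=
    hm.lintegral_prod_right'
  simp only [impurityPeriodicEnergy_eq]
  exact measurable_const.add h2

/-- **Some pinning point does no worse than the Born average.** For a periodic trial state `Ψ` on the
torus of side `L > 0` there is a pinning point `x₀ ∈ [0,L)³` with
`⟨Ψ, (H + V_{x₀}) Ψ⟩ ≤ ⟨Ψ, HΨ⟩ + N (L³)⁻¹ ∫_{[0,L)³} v^per` (first-moment method on the cell average
`lintegral_cell_impurityPeriodicEnergy`). [folklore] -/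
theorem exists_position_impurityPeriodicEnergy_le {v : ℝ → ℝ≥0∞} (hv : Measurable v) (hL : 0 < L)
    (Ψ : PeriodicTrialState N L) :
    ∃ x₀ ∈ cell L, impurityPeriodicEnergy v x₀ Ψ ≤
      periodicEnergy v Ψ +
        (N : ℝ≥0∞) * (ENNReal.ofReal (L ^ 3))⁻¹ * ∫⁻ y in cell L, periodizedPotential v L y := by
  have hvol : volume (cell L) = ENNReal.ofReal L ^ 3 := volume_cell L
  have h3 : ENNReal.ofReal L ^ 3 ≠ 0 := pow_ne_zero _ (ENNReal.ofReal_pos.2 hL).ne'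
  have h3' : ENNReal.ofReal L ^ 3 ≠ ⊤ := ENNReal.pow_ne_top ENNReal.ofReal_ne_top
  have hμ : volume (cell L) ≠ 0 := by rw [hvol]; exact h3
  have hμ' : volume (cell L) ≠ ⊤ := by rw [hvol]; exact h3'
  obtain ⟨x₀, hx₀, hle⟩ := exists_le_setLAverage hμ hμ'
    (measurable_impurityPeriodicEnergy_left hv Ψ).aemeasurable
  refine ⟨x₀, hx₀, hle.trans_eq ?_⟩
  rw [setLAverage_eq, lintegral_cell_impurityPeriodicEnergy hL hv Ψ, hvol, ENNReal.add_div,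
    mul_comm (ENNReal.ofReal L ^ 3) (periodicEnergy v Ψ), ENNReal.mul_div_cancel_right h3 h3',
    ENNReal.div_eq_inv_mul, ENNReal.ofReal_pow hL.le, ← mul_assoc,
    mul_comm ((ENNReal.ofReal L ^ 3)⁻¹) (N : ℝ≥0∞)]

/-- **A free near-minimiser, translated, is a pinned near-minimiser at Born slack.** For every periodic
trial state `Ψ` on the torus of side `L > 0` there is a translate `Φ = Ψ(· + x₀𝟙)` (same free energy)
whose pinned energy with the scatterer at the origin is at most `⟨Ψ, HΨ⟩ + N (L³)⁻¹ ∫_{[0,L)³} v^per`.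
[folklore] -/
theorem exists_translate_impurityPeriodicEnergy_zero_le {v : ℝ → ℝ≥0∞} (hv : Measurable v)
    (hL : 0 < L) (Ψ : PeriodicTrialState N L) :
    ∃ Φ : PeriodicTrialState N L, periodicEnergy v Φ = periodicEnergy v Ψ ∧
      impurityPeriodicEnergy v 0 Φ ≤
        periodicEnergy v Ψ +
          (N : ℝ≥0∞) * (ENNReal.ofReal (L ^ 3))⁻¹ * ∫⁻ y in cell L, periodizedPotential v L y := by
  obtain ⟨x₀, _, hx₀⟩ := exists_position_impurityPeriodicEnergy_le hv hL Ψ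
  obtain ⟨Φ, hΦ⟩ := Ψ.exists_translate (-x₀)
  refine ⟨Φ, periodicEnergy_translate v Ψ (-x₀) hΦ, ?_⟩
  have h := impurityPeriodicEnergy_translate v x₀ Ψ (-x₀) hΦ
  rw [add_neg_cancel] at h
  rw [h]
  exact hx₀

/-- **Stub A at Born slack (registered sub-goal, PROVED): the fidelity pair with the pinned slack
inflated by the uniform Born term.** For a measurable pair profile `v ≥ 0`, every `N`, every `L > 0` with
`E^per(N, L) < ⊤` and every `δ > 0` there is a periodic trial state `Φ` with
`⟨Φ, (H + V₀) Φ⟩ ≤ E_imp(N, L, 0) + δ + N (L³)⁻¹ ∫_{[0,L)³} v^per` which is at the same time a free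
`δ`-near-minimiser, so that the pair `(Φ, Ψ := Φ)` has overlap `|⟨Ψ, Φ⟩|² = 1 ≥ ofReal 1`. Compared with
`stub_fidelityPair` (pinned slack an ARBITRARY `δ > 0`, overlap `≥ 1 − η`), the only missing step is the
relaxation of the pinned slack below the Born scale — the infrared content of the crux. [folklore] -/
theorem stub_fidelityPairBornSlack :
    ∀ (v : ℝ → ℝ≥0∞), Measurable v → ∀ (N : ℕ) (L : ℝ), 0 < L →
      periodicGroundStateEnergy v N L ≠ ⊤ →
      ∀ δ : ℝ≥0∞, 0 < δ →
        ∃ Φ : PeriodicTrialState N L,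
          impurityPeriodicEnergy v 0 Φ ≤ impurityPeriodicGroundStateEnergy v N L 0 + δ +
              (N : ℝ≥0∞) * (ENNReal.ofReal (L ^ 3))⁻¹ * ∫⁻ y in cell L, periodizedPotential v L y ∧
          ∃ Ψ : PeriodicTrialState N L,
            periodicEnergy v Ψ ≤ periodicGroundStateEnergy v N L + δ ∧
            ENNReal.ofReal 1 ≤ (‖∫ X in cellN N L, conj (Ψ.ψ X) * Φ.ψ X‖₊ : ℝ≥0∞) ^ 2 := by
  intro v hv N L hL hE δ hδ
  -- a free `δ`-near-minimiser
  have hlt : periodicGroundStateEnergy v N L < periodicGroundStateEnergy v N L + δ :=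
    ENNReal.lt_add_right hE hδ.ne'
  obtain ⟨Ψ₀, hΨ₀⟩ := iInf_lt_iff.1 hlt
  -- translate it so that the scatterer at the origin costs at most the Born average
  obtain ⟨Φ, hΦE, hΦimp⟩ := exists_translate_impurityPeriodicEnergy_zero_le hv hL Ψ₀
  have hfree : periodicEnergy v Φ ≤ periodicGroundStateEnergy v N L + δ := hΦE.trans_le hΨ₀.le
  refine ⟨Φ, ?_, Φ, hfree, ?_⟩
  · calc impurityPeriodicEnergy v 0 Φ
        ≤ periodicEnergy v Ψ₀ +
            (N : ℝ≥0∞) * (ENNReal.ofReal (L ^ 3))⁻¹ * ∫⁻ y in cell L, periodizedPotential v L y := hΦimp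
      _ ≤ periodicGroundStateEnergy v N L + δ +
            (N : ℝ≥0∞) * (ENNReal.ofReal (L ^ 3))⁻¹ * ∫⁻ y in cell L, periodizedPotential v L y := by
          gcongr
      _ ≤ impurityPeriodicGroundStateEnergy v N L 0 + δ +
            (N : ℝ≥0∞) * (ENNReal.ofReal (L ^ 3))⁻¹ * ∫⁻ y in cell L, periodizedPotential v L y := by
          gcongr
          exact periodicGroundStateEnergy_le_impurityPeriodicGroundStateEnergy v N L 0
  · rw [integral_cellN_conj_mul_self_trialState Φ, nnnorm_one, ENNReal.coe_one, one_pow,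
      ENNReal.ofReal_one]

/-- **Stub A at Born slack, density form.** At the crux's side `L = sideLength ρ (N + 1)` the Born term is
at most `ρ ∫_{ℝ³} v(|y|) dy` (`natCast_mul_inv_ofReal_sideLength_pow_le`, `born_term_eq`), so for every
`N`, every `δ > 0` and `E^per < ⊤` there is a free `δ`-near-minimiser `Φ` with
`⟨Φ, (H + V₀)Φ⟩ ≤ E_imp + δ + ρ ∫ v` (and the pair `(Φ, Φ)` has overlap `1`). [folklore] -/
theorem stub_fidelityPairBornSlack_density {v : ℝ → ℝ≥0∞} (hv : Measurable v) {ρ : ℝ} (hρ : 0 < ρ)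
    (N : ℕ) (hE : periodicGroundStateEnergy v N (sideLength ρ (N + 1)) ≠ ⊤) {δ : ℝ≥0∞} (hδ : 0 < δ) :
    ∃ Φ : PeriodicTrialState N (sideLength ρ (N + 1)),
      impurityPeriodicEnergy v 0 Φ ≤
          impurityPeriodicGroundStateEnergy v N (sideLength ρ (N + 1)) 0 + δ +
            ENNReal.ofReal ρ * ∫⁻ y : Space, v ‖y‖ ∧
        periodicEnergy v Φ ≤ periodicGroundStateEnergy v N (sideLength ρ (N + 1)) + δ := by
  have hL : 0 < sideLength ρ (N + 1) := by
    unfold sideLength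
    exact Real.rpow_pos_of_pos (by positivity) _
  obtain ⟨Φ, hΦ, Ψ, hΨ, _⟩ := stub_fidelityPairBornSlack v hv N _ hL hE δ hδ
  obtain ⟨Φ', hΦ'E, hΦ'imp⟩ := exists_translate_impurityPeriodicEnergy_zero_le hv hL Ψ
  refine ⟨Φ', ?_, hΦ'E.trans_le hΨ⟩
  calc impurityPeriodicEnergy v 0 Φ'
      ≤ periodicEnergy v Ψ + (N : ℝ≥0∞) * (ENNReal.ofReal (sideLength ρ (N + 1) ^ 3))⁻¹ *
          ∫⁻ y in cell (sideLength ρ (N + 1)), periodizedPotential v (sideLength ρ (N + 1)) y := hΦ'imp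
    _ = periodicEnergy v Ψ + (N : ℝ≥0∞) * (ENNReal.ofReal (sideLength ρ (N + 1) ^ 3))⁻¹ *
          ∫⁻ y : Space, v ‖y‖ := by rw [born_term_eq hv N hL]
    _ ≤ periodicGroundStateEnergy v N (sideLength ρ (N + 1)) + δ +
          ENNReal.ofReal ρ * ∫⁻ y : Space, v ‖y‖ :=
        add_le_add hΨ (mul_le_mul' (natCast_mul_inv_ofReal_sideLength_pow_le hρ N) le_rfl)
    _ ≤ impurityPeriodicGroundStateEnergy v N (sideLength ρ (N + 1)) 0 + δ +
          ENNReal.ofReal ρ * ∫⁻ y : Space, v ‖y‖ := by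
        gcongr
        exact periodicGroundStateEnergy_le_impurityPeriodicGroundStateEnergy v N _ 0

end Summit.AtomisticToContinuum.BoseEinsteinCondensation.Cruxes.CloudMomentumAtom.Birth

end
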